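import Summits.Ventures.CertifiedArithmetic.LowPrec.SRFast2Sum
import HarnessLib

/-!
# 2Sum (Knuth–Møller) under stochastic rounding: exactly unbiased, every format (file XXXVII)

HONEST FRAMING: certified error envelopes and provably optimal rounding/accumulation schemes for
low-precision formats under stated cost models; every table by two implementations; no hardware or
vendor claims.

File XXXIV (`SRFast2Sum`) settled Fast2Sum under saturating SR (`|b| ≤ |a|` known). This file
settles the branch-free error-free transformation 2SUM — six operations, NO order hypothesis —
when every one of its six roundings is an independent saturating stochastic rounding into the
format (`step` of file I):

  `s = SR₁(a + b)`, `a' = SR₂(s − b)`, `b' = SR₃(s − a')`, `δa = SR₄(a − a')`,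
  `δb = SR₅(b − b')`, `t = SR₆(δa + δb)`.

* `twoSumE F a b f` — the expectation operator `E f(s, t)` of the algorithm (generic `F`).
* GENERIC REDUCTION `twoSumE_add_of_inHull`: if on every faithful branch the pre-rounding values
  of operations 3–6 lie in the representable hull, then `E[s + t] = a + b` EXACTLY —
  operations 1 and 2 may saturate freely (pure linearity:
  `E[t ∣ s, a'] = (a − a') + (b − (s − a')) = a + b − s`).
* EVERY FORMAT (`valueSet φ`, at least one mantissa bit), EVERY PAIR of data, saturation included:
  - `sub_mem_twoSum`: `s − a' ∈ F` on every branch — operation 3 is EXACT SURELY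
    (`b' = s − a'`), also when operation 1 or 2 saturates;
  - `twoSum_a'_sign`, `twoSum_b'_sign`: `a'` has the weak sign of `a`, `b'` that of `b`, hence
    operations 4 and 5 never leave the hull;
  - `twoSum_corr_abs_le`: `|δa + δb| ≤ maxRat` on every branch (attained at `a = b = maxRat`)
    — operation 6 never saturates;
  - **`twoSumE_add`: `E[s + t] = a + b` for ALL `a, b`** — 2Sum under SR is an exactly unbiased
    compensated pair on the whole format, although `E s ≠ a + b` whenever `a + b` leaves the hull
    and although `t` itself is NOT always the exact error (E3M2: `P(s + t = a + b)` can be `81/256`,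
    cell certificate `certs/sr/gen7/eft/`).
* Kernel witnesses on the literal FP4 table: the pair `(−6, 1/2)` where operation 2 saturates on
  one branch, and `(6, 6)` where operation 1 saturates (`E s = 6`, `E[s + t] = 12`); the all-pairs
  kernel evaluation of FP4 (and its SURE exactness there) is file XXXIX (`SRTwoSumE2M1`).

THIS FILE (part 1 of 2): the operator, the generic reduction, the order facts and OPERATION 3
(`sub_mem_twoSum`, `twoSumE_eq`), operations 4–5 in the hull.  Part 2 (`SRTwoSumUnbiased`,
file XXXVIII): operation 6, the headline `twoSumE_add`, the kernel witnesses.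

Nearest prior art.  Boldo–Graillat–Muller [BoldoGraillatMuller2017] analyse 2Sum with arbitrary
("faithful") deterministic rounding functions WITHOUT overflow: Thm 4.1 (`p ≥ 4`:
`t = a + b − s + α`, `|α| < 2^{1−p} ulp(a+b)`), Lemma 4.2 (`|δa + δb| ≤ ulp(a + b)`),
eq. (5) (`b' = s − a'`) and Thm 6.2 (no overflow at lines 2–6 when `|a| < Ω` and line 1 does not
overflow).  Every SR branch is a faithful rounding, so their branchwise facts are the template; new
here: (i) the SATURATING finite model (no `±∞`; lines 1–2 DO saturate and are clamped), where
the hull facts hold with no exception (`|a| = Ω` included) and need only one mantissa bit; (ii) the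
probabilistic statement — exact unbiasedness of `s + t` — which has no deterministic analogue;
(iii) kernel cross-checks on FP4.  SR literature (CHM21, the 2022 survey
[CrociEtAl2022]) has no error-free-transformation-under-SR statement; EFTs are
used there under round-to-nearest to IMPLEMENT SR, the opposite direction.
-/

namespace Summit.Ventures.CertifiedArithmetic.LowPrec.SR

open Literature.ComputerArithmetic.ConnollyHighamMary2021
open Literature.ComputerArithmetic.FloatingPoint
open Finset

section Generic

variable {K : Type*} [Field K] [LinearOrder K] [IsStrictOrderedRing K]

/-- 2Sum EXECUTED UNDER SATURATING SR, as an expectation operator: `E f(s, t)` for the six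
independent saturating stochastic roundings `s = SR(a + b)`, `a' = SR(s − b)`,
`b' = SR(s − a')`, `δa = SR(a − a')`, `δb = SR(b − b')`, `t = SR(δa + δb)`.
[cite: BoldoGraillatMuller2017, Algorithm 4 (2Sum with faithful roundings); SR semantics new] -/
def twoSumE (F : Finset K) (a b : K) (f : K → K → K) : K :=
  step F (a + b) fun s => step F (s - b) fun a' => step F (s - a') fun b' =>
    step F (a - a') fun da => step F (b - b') fun db => step F (da + db) fun t => f s t

/-! ### Faithful roundings: order facts -/

omit [Field K] [IsStrictOrderedRing K] in
/-- A faithful rounding of `c` lies below every element of `F` above `c`. -/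
theorem Faithful.le_of_mem {F : Finset K} {c s y : K} (hs : Faithful F c s) (hy : y ∈ F)
    (hcy : c ≤ y) : s ≤ y := by
  rcases hs.2 with ⟨hsc, -⟩ | ⟨-, hmin⟩
  · exact hsc.trans hcy
  · exact hmin y hy hcy

omit [Field K] [IsStrictOrderedRing K] in
/-- A faithful rounding of `c` lies above every element of `F` below `c`. -/
theorem Faithful.ge_of_mem {F : Finset K} {c s y : K} (hs : Faithful F c s) (hy : y ∈ F)
    (hyc : y ≤ c) : y ≤ s := by
  rcases hs.2 with ⟨-, hmax⟩ | ⟨hcs, -⟩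
  · exact hmax y hy hyc
  · exact hyc.trans hcs

omit [Field K] [IsStrictOrderedRing K] in
/-- A faithful (saturating) rounding is one of the two SR candidates. -/
theorem Faithful.eq_dn_or_up {F : Finset K} {c s : K} (hs : Faithful F c s) :
    s = dn F c ∨ s = up F c := by
  have hF : F.Nonempty := ⟨s, hs.1⟩
  rcases hs.2 with ⟨hsc, hmax⟩ | ⟨hcs, hmin⟩
  · left
    have h1 : dn F c ≤ c := (dn_le_clamp F c).trans (clamp_le_self_of_mem hs.1 hsc)
    exact le_antisymm (le_dn_of_mem hs.1 hsc) (hmax _ (dn_mem hF c) h1)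
  · right
    have h1 : c ≤ up F c := (self_le_clamp_of_mem hs.1 hcs).trans (clamp_le_up F c)
    exact le_antisymm (hmin _ (up_mem hF c) h1) (up_le_of_mem hs.1 hcs)

omit [Field K] [IsStrictOrderedRing K] in
/-- `⌊c⌋ ≤ s ≤ ⌈c⌉` for a faithful rounding `s` of `c`. -/
theorem Faithful.dn_le_le_up {F : Finset K} {c s : K} (hs : Faithful F c s) :
    dn F c ≤ s ∧ s ≤ up F c := by
  have h := (dn_le_clamp F c).trans (clamp_le_up F c)
  rcases hs.eq_dn_or_up with h1 | h1 <;> rw [h1]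
  · exact ⟨le_rfl, h⟩
  · exact ⟨h, le_rfl⟩

/-- Inside the hull the committed error of a faithful rounding is at most the candidate gap. -/
theorem Faithful.abs_err_le_gap {F : Finset K} {c s : K} (hc : InHull F c) (hs : Faithful F c s) :
    |c - s| ≤ up F c - dn F c := by
  obtain ⟨h1, h2⟩ := hs.dn_le_le_up
  have h3 : dn F c ≤ c := by simpa only [clamp_eq_self hc] using dn_le_clamp F c
  have h4 : c ≤ up F c := by simpa only [clamp_eq_self hc] using clamp_le_up F c
  rw [abs_le]; constructor <;> linarith

omit [IsStrictOrderedRing K] in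
/-- `E[u + SR(c)] = u + c` for `c` in the hull. -/
theorem step_const_add {F : Finset K} {c : K} (hc : InHull F c) (u : K) :
    step F c (fun t => u + t) = u + c := by
  rw [step_add F c (fun _ => u) (fun t => t), step_const, step_id, clamp_eq_self hc]

omit [IsStrictOrderedRing K] in
/-- `E[u − SR(c)] = u − c` for `c` in the hull. -/
theorem step_const_sub {F : Finset K} {c : K} (hc : InHull F c) (u : K) :
    step F c (fun t => u - t) = u - c := by
  have e : (fun t : K => u - t) = fun t => u + (-1) * t := by funext t; ring
  rw [e, step_add F c (fun _ => u) (fun t => (-1) * t), step_const, step_mul_left, step_id,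
    clamp_eq_self hc]; ring

/-! ### Generic reduction: hull-safety of operations 3–6 ⟹ exact unbiasedness -/

omit [IsStrictOrderedRing K] in
/-- **GENERIC REDUCTION.** If on every faithful branch `(s, a', b', δa, δb)` the pre-rounding
values of operations 3–6 (`s − a'`, `a − a'`, `b − b'`, `δa + δb`) lie in the representable hull
of `F`, then 2Sum under saturating SR satisfies `E[s + t] = a + b` exactly.  Operations 1 and 2
are unrestricted (they may saturate): by linearity
`E[t ∣ s, a'] = (a − a') + (b − (s − a')) = a + b − s` whatever `s` and `a'` are. [new] -/
theorem twoSumE_add_of_inHull {F : Finset K} (hF : F.Nonempty) (a b : K)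
    (h : ∀ s, Faithful F (a + b) s → ∀ a', Faithful F (s - b) a' →
      InHull F (s - a') ∧ InHull F (a - a') ∧ ∀ b', Faithful F (s - a') b' →
        InHull F (b - b') ∧ ∀ da, Faithful F (a - a') da → ∀ db, Faithful F (b - b') db →
          InHull F (da + db)) :
    twoSumE F a b (fun s t => s + t) = a + b := by
  unfold twoSumE
  refine step_eq_of_faithful hF _ fun s hs => step_eq_of_faithful hF _ fun a' ha' => ?_
  obtain ⟨h3, h4, h5⟩ := h s hs a' ha'
  have e3 : (fun b' => step F (a - a') fun da => step F (b - b') fun db =>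
      step F (da + db) fun t => s + t) = fun b' => step F (a - a') fun da =>
        step F (b - b') fun db => step F (da + db) fun t => s + t := rfl
  calc step F (s - a') (fun b' => step F (a - a') fun da => step F (b - b') fun db =>
          step F (da + db) fun t => s + t)
      = step F (s - a') (fun b' => (s + (a - a') + b) - b') := by
        refine step_congr_faithful hF _ fun b' hb' => ?_
        obtain ⟨h5', h6⟩ := h5 b' hb'
        calc step F (a - a') (fun da => step F (b - b') fun db => step F (da + db) fun t => s + t)
            = step F (a - a') (fun da => (s + (b - b')) + da) := by
              refine step_congr_faithful hF _ fun da hda => ?_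
              calc step F (b - b') (fun db => step F (da + db) fun t => s + t)
                  = step F (b - b') (fun db => (s + da) + db) := by
                    refine step_congr_faithful hF _ fun db hdb => ?_
                    rw [step_const_add (h6 da hda db hdb) s]; ring
                _ = (s + (b - b')) + da := by rw [step_const_add h5' (s + da)]; ring
          _ = (s + (a - a') + b) - b' := by rw [step_const_add h4]; ring
    _ = a + b := by rw [step_const_sub h3]; ring

end Generic

section Formats

open Literature.ComputerArithmetic.FloatingPoint.MiniFloat

variable {φ : Format}

/-! ### Order facts on the branches `s ∈ SR(a + b)`, `a' ∈ SR(s − b)` (every format) -/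

/-- `0 ≤ a ⟹ b ≤ s` for every faithful rounding `s` of `a + b` (`b ∈ F` lies below `a + b`).
-/
theorem le_of_faithful_add (a b : MiniFloat φ) (ha : 0 ≤ a.toRat) {s : ℚ}
    (hs : Faithful (valueSet φ) (a.toRat + b.toRat) s) : b.toRat ≤ s :=
  hs.ge_of_mem (toRat_mem_valueSet b) (by linarith)

/-- `a ≤ 0 ⟹ s ≤ b` for every faithful rounding `s` of `a + b`. -/
theorem ge_of_faithful_add (a b : MiniFloat φ) (ha : a.toRat ≤ 0) {s : ℚ}
    (hs : Faithful (valueSet φ) (a.toRat + b.toRat) s) : s ≤ b.toRat :=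
  hs.le_of_mem (toRat_mem_valueSet b) (by linarith)

/-- `0 ∈ F` (also in file `SRRungR3Exact`, not imported here). -/
private theorem zero_mem (φ : Format) : (0 : ℚ) ∈ valueSet φ := by
  simpa using toRat_mem_valueSet (MiniFloat.zero φ)

/-- **SIGN OF `a'`** (operation 2 of 2Sum, every format, saturation included): `a' ∈ SR(s − b)`
has the weak sign of `a`: `0 ≤ a ⟹ 0 ≤ a'` and `a ≤ 0 ⟹ a' ≤ 0`.
[cite: BoldoGraillatMuller2017, proof of Thm 6.2 (`b > 0`: `0 ≤ a' ≤ s`); saturating form new]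
-/
theorem twoSum_a'_sign (a b : MiniFloat φ) {s a' : ℚ}
    (hs : Faithful (valueSet φ) (a.toRat + b.toRat) s)
    (ha' : Faithful (valueSet φ) (s - b.toRat) a') :
    (0 ≤ a.toRat → 0 ≤ a') ∧ (a.toRat ≤ 0 → a' ≤ 0) := by
  refine ⟨fun ha => ?_, fun ha => ?_⟩
  · have := le_of_faithful_add a b ha hs
    exact ha'.ge_of_mem (zero_mem φ) (by linarith)
  · have := ge_of_faithful_add a b ha hs
    exact ha'.le_of_mem (zero_mem φ) (by linarith)

/-- **SIGN OF `b' = s − a'`**: `0 ≤ b ⟹ a' ≤ s` and `b ≤ 0 ⟹ s ≤ a'`, i.e. `s − a'` has the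
weak sign of `b`.
[cite: BoldoGraillatMuller2017, proof of Thm 6.2 (`0 ≤ b' ≤ s`); saturating form new] -/
theorem twoSum_b'_sign (a b : MiniFloat φ) {s a' : ℚ}
    (hs : Faithful (valueSet φ) (a.toRat + b.toRat) s)
    (ha' : Faithful (valueSet φ) (s - b.toRat) a') :
    (0 ≤ b.toRat → a' ≤ s) ∧ (b.toRat ≤ 0 → s ≤ a') :=
  ⟨fun hb => ha'.le_of_mem hs.1 (by linarith), fun hb => ha'.ge_of_mem hs.1 (by linarith)⟩

/-! ### Operation 3 is exact: `s − a' ∈ F` on every branch -/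

/-- Cancellation case, `0 < b`, `|s| < b`: then `s − b` itself is a value (so `a' = s − b`). -/
theorem sub_mem_of_faithful_abs_lt_pos (a b : MiniFloat φ) (hb : 0 < b.toRat) {s : ℚ}
    (hs : Faithful (valueSet φ) (a.toRat + b.toRat) s) (hsb : |s| < b.toRat) :
    s - b.toRat ∈ valueSet φ := by
  set c := a.toRat + b.toRat with hc_def
  have hq := φ.quantum_pos
  have hbF := toRat_mem_valueSet b
  have haF := toRat_mem_valueSet a
  rw [abs_lt] at hsb
  -- `a < 0`, else `b ≤ s`
  have ha : a.toRat < 0 := by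
    by_contra h; push Not at h
    have := le_of_faithful_add a b h hs; linarith
  -- if `c ∈ F` then `s = c` and `s − b = a`
  have key : c ∈ valueSet φ → s - b.toRat ∈ valueSet φ := fun hcF => by
    rw [hs.eq_of_mem hcF, show c - b.toRat = a.toRat by rw [hc_def]; ring]; exact haF
  set A := a.flipSign.toRat with hA_def
  have hA : A = -a.toRat := toRat_flipSign a
  have hA0 : 0 ≤ A := by rw [hA]; linarith
  rcases le_or_gt A b.toRat with hAb | hAb
  · -- `0 ≤ c = b − A ≤ b`
    rcases le_or_gt b.toRat (2 * A) with h2 | h2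
    · -- Sterbenz on `(b, A)`: `c ∈ F`
      apply key
      obtain ⟨d, hd⟩ := sterbenz b a.flipSign (by rw [← hA_def]; linarith)
        (by rw [← hA_def]; linarith)
      exact mem_valueSet.mpr ⟨d, by rw [hd, ← hA_def, hA, hc_def]; ring⟩
    · -- `A < b/2`: `c > b/2`; either `b/2 ∈ F` (then `b/2 ≤ s ≤ b`, Sterbenz on `(s, b)`) or
      -- the bottom binades (then `c ∈ F`)
      rcases half_mem_valueSet_or_lt b hb.le with hhalf | hsmall
      · have h1 : b.toRat / 2 ≤ s :=
          hs.ge_of_mem hhalf (by rw [hc_def, ← neg_neg a.toRat, ← hA]; linarith)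
        have h2 : s ≤ b.toRat := hs.le_of_mem hbF (by rw [hc_def]; linarith)
        obtain ⟨s₀, hs₀⟩ := mem_valueSet.mp hs.1
        obtain ⟨d, hd⟩ := sterbenz s₀ b (by rw [hs₀]; exact h1) (by rw [hs₀]; linarith)
        exact mem_valueSet.mpr ⟨d, by rw [hd, hs₀]⟩
      · apply key
        have hB := toInt_eq_scaledMag_of_nonneg hb.le
        have hcN : c = ((a.toInt + b.toInt : ℤ) : ℚ) * φ.quantum := by
          rw [hc_def]; unfold MiniFloat.toRat; push_cast; ring
        rw [hcN]
        apply intCast_mul_mem_valueSet hsmall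
        have hc0 : 0 ≤ c := by rw [hc_def, ← neg_neg a.toRat, ← hA]; linarith
        have hcb : c ≤ b.toRat := by rw [hc_def]; linarith
        have h0 : (0 : ℤ) ≤ a.toInt + b.toInt := by
          have h : (0 : ℚ) * φ.quantum ≤ ((a.toInt + b.toInt : ℤ) : ℚ) * φ.quantum := by
            rw [zero_mul, ← hcN]; exact hc0
          exact_mod_cast le_of_mul_le_mul_right h hq
        have h1 : a.toInt + b.toInt ≤ (b.scaledMag : ℤ) := by
          have h : ((a.toInt + b.toInt : ℤ) : ℚ) * φ.quantum
              ≤ ((b.scaledMag : ℤ) : ℚ) * φ.quantum := by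
            rw [← hcN]; unfold MiniFloat.toRat at hcb; rw [hB] at hcb; exact_mod_cast hcb
          exact_mod_cast le_of_mul_le_mul_right h hq
        omega
  · -- `c = b − A < 0`
    rcases le_or_gt A (2 * b.toRat) with h2 | h2
    · -- Sterbenz on `(A, b)`: `A − b ∈ F`, hence `c = −(A − b) ∈ F`
      apply key
      obtain ⟨d, hd⟩ := sterbenz a.flipSign b (by rw [← hA_def]; linarith)
        (by rw [← hA_def]; linarith)
      have h := neg_mem_valueSet (toRat_mem_valueSet d)
      rw [hd, ← hA_def, hA] at h
      convert h using 1; rw [hc_def]; ring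
    · -- `2b < A`: `c < −b`, so `s ≤ −b`, contradicting `|s| < b`
      exfalso
      have h := hs.le_of_mem (neg_mem_valueSet hbF)
        (by rw [hc_def, ← neg_neg a.toRat, ← hA]; linarith)
      linarith

/-- **OPERATION 3 OF 2SUM IS EXACT, EVERY FORMAT, EVERY BRANCH, SATURATION INCLUDED**: for data
`a, b`, any faithful saturating rounding `s` of `a + b` and any faithful saturating rounding `a'` of
`s − b`, the value `s − a'` is representable — so `b' = SR(s − a') = s − a'` surely.
[cite: BoldoGraillatMuller2017, eq. (5) in the proof of Thm 4.1 (no overflow, deterministic);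
saturating SR model, one mantissa bit not even needed: new] -/
theorem sub_mem_twoSum (a b : MiniFloat φ) {s a' : ℚ}
    (hs : Faithful (valueSet φ) (a.toRat + b.toRat) s)
    (ha' : Faithful (valueSet φ) (s - b.toRat) a') : s - a' ∈ valueSet φ := by
  rcases le_or_gt |b.toRat| |s| with h | h
  · -- `|b| ≤ |s|`: file XXXIII on the pair `(s, −b)`
    obtain ⟨s₀, hs₀⟩ := mem_valueSet.mp hs.1
    have h1 : Faithful (valueSet φ) (s₀.toRat + b.flipSign.toRat) a' := by
      rw [hs₀, toRat_flipSign, ← sub_eq_add_neg]; exact ha'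
    have h2 := sub_mem_of_faithful s₀ b.flipSign
      (by rw [toRat_flipSign, abs_neg, hs₀]; exact h) h1
    rw [hs₀] at h2
    have h3 := neg_mem_valueSet h2
    convert h3 using 1; ring
  · -- `|s| < |b|`: cancellation, `s − b ∈ F`, `a' = s − b`, `s − a' = b`
    have hsb : s - b.toRat ∈ valueSet φ := by
      have hb0 : b.toRat ≠ 0 := fun h0 => by
        rw [h0, abs_zero] at h; exact absurd h (not_lt.mpr (abs_nonneg s))
      rcases lt_or_gt_of_ne hb0 with hb | hb
      · -- `b < 0`: flip all signs
        have hs' : Faithful (valueSet φ) (a.flipSign.toRat + b.flipSign.toRat) (-s) := by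
          rw [toRat_flipSign, toRat_flipSign, ← neg_add]
          exact hs.neg fun y hy => neg_mem_valueSet hy
        have h1 := sub_mem_of_faithful_abs_lt_pos a.flipSign b.flipSign
          (by rw [toRat_flipSign]; linarith) hs'
          (by rw [toRat_flipSign, abs_neg, ← abs_of_neg hb]; exact h)
        rw [toRat_flipSign] at h1
        have h2 := neg_mem_valueSet h1
        convert h2 using 1; ring
      · exact sub_mem_of_faithful_abs_lt_pos a b hb hs (by rwa [abs_of_pos hb] at h)
    rw [ha'.eq_of_mem hsb, show s - (s - b.toRat) = b.toRat by ring]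
    exact toRat_mem_valueSet b

/-- Under SR: `E f(s, a', b') = E f(s, a', s − a')` — operation 3 can be struck from the
algorithm (it returns `s − a'` with probability one), for every format and all data. -/
theorem twoSumE_eq (a b : MiniFloat φ) (f : ℚ → ℚ → ℚ) :
    twoSumE (valueSet φ) a.toRat b.toRat f =
      step (valueSet φ) (a.toRat + b.toRat) fun s => step (valueSet φ) (s - b.toRat) fun a' =>
        step (valueSet φ) (a.toRat - a') fun da =>
          step (valueSet φ) (b.toRat - (s - a')) fun db =>
            step (valueSet φ) (da + db) fun t => f s t := by
  unfold twoSumE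
  refine step_congr_faithful (valueSet_nonempty φ) _ fun s hs =>
    step_congr_faithful (valueSet_nonempty φ) _ fun a' ha' => ?_
  simp only [step_of_mem (sub_mem_twoSum a b hs ha')]

/-! ### Operations 4, 5: in the hull -/

/-- `|a − a'| ≤ maxRat` on every branch (operation 4 never saturates). -/
theorem twoSum_op4_inHull (a b : MiniFloat φ) {s a' : ℚ}
    (hs : Faithful (valueSet φ) (a.toRat + b.toRat) s)
    (ha' : Faithful (valueSet φ) (s - b.toRat) a') : InHull (valueSet φ) (a.toRat - a') := by
  rw [valueSet_inHull_iff, abs_le]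
  have hA := abs_le.mp (abs_toRat_le_maxRat a)
  have hA' := abs_le.mp (abs_le_maxRat_of_mem_valueSet ha'.1)
  obtain ⟨h1, h2⟩ := twoSum_a'_sign a b hs ha'
  rcases le_or_gt 0 a.toRat with ha | ha
  · have := h1 ha; constructor <;> linarith
  · have := h2 ha.le; constructor <;> linarith

/-- `|b − (s − a')| ≤ maxRat` on every branch (operation 5 never saturates). -/
theorem twoSum_op5_inHull (a b : MiniFloat φ) {s a' : ℚ}
    (hs : Faithful (valueSet φ) (a.toRat + b.toRat) s)
    (ha' : Faithful (valueSet φ) (s - b.toRat) a') :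
    InHull (valueSet φ) (b.toRat - (s - a')) := by
  rw [valueSet_inHull_iff, abs_le]
  have hB := abs_le.mp (abs_toRat_le_maxRat b)
  have hB' := abs_le.mp (abs_le_maxRat_of_mem_valueSet (sub_mem_twoSum a b hs ha'))
  obtain ⟨h1, h2⟩ := twoSum_b'_sign a b hs ha'
  rcases le_or_gt 0 b.toRat with hb | hb
  · have := h1 hb; constructor <;> linarith
  · have := h2 hb.le; constructor <;> linarith

end Formats

end Summit.Ventures.CertifiedArithmetic.LowPrec.SR
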